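import Summits.CriticalPhenomena.SAWScalingLimit.Theses.SAWImaginaryGeometry
import Summits.CriticalPhenomena.SAWScalingLimit.Theorems.SAWLoopFugacityFlowSimpleSubseqLimitsStubDescribable
import Literature.Probability.RandomPlanarGeometry.CrossingCondition
import Literature.Probability.RandomPlanarGeometry.LatticeFlowLinePassage

/-!
# Line `birth` — registered skeleton for the crux `SubseqDescribable` (stmt-CriticalPhenomena-5943)

Crux (FIXED; rank 4 of `route-CriticalPhenomena-SAWImaginaryGeometry`, decl
`Summit.CriticalPhenomena.SAWScalingLimit.Theses.SAWImaginaryGeometry.SubseqDescribable`): for every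
Dobrushin domain `D`, EVERY endpoint approximation `(a, b)` (`SAW.IsEndpointApprox`), every sequence of
meshes `s n → 0⁺`, every weak (probability) limit `μ` of the critical `δℤ²` SAW laws of
`(D_δ; a_δ, b_δ)` along `s`, and every chordal uniformizing map `φ : ℍ → D`,
`μ`-a.e. curve class is Loewner-describable through `φ` (`IsLoewnerDescribable`). The crux's own
docstring names the intended engine: Kemppainen–Smirnov, Ann. Probab. 45 (2017), Thm. 1.5 /
Cor. 1.7 from an annulus-crossing bound (Condition G) for the `x_c`-SAW, whose domain Markov
property is exact.

## What the tree already has (used, not re-stubbed)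

* the DETERMINISTIC half of KS Thm. 1.5 (ii) in event form for approximating domains, read along a
  weakly convergent sequence with the laws honest only eventually:
  `Theorems.SimpleSubseqLimits.CapacityClock.Describable.ae_isLoewnerDescribable_of_eventually_regular`
  (landed p100275 for the twin crux stmt-4982) and the honesty lemma
  `Theorems.SimpleSubseqLimits.Negative.eventually_isProbabilityMeasure_of_weakLimitAlong`; from them
  this file PROVES `ae_isLoewnerDescribable_of_isKSRegularAlongMesh`: the Literature interface
  `IsKSRegularAlongMesh D φ (curve) (SAW.law)` (KS regularity along the MESH through approximating
  Dobrushin domains and maps, `LatticeFlowLinePassage.lean` — the form every FK/percolation route of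
  the tree consumes) gives `μ`-a.e. describability through `φ` of every subsequential weak limit;
* the exact domain Markov property of the critical SAW law on cell domains
  (`Theorems.SimpleSubseqLimits.CapacityClock.DomainMarkov.stub_sawDomainMarkov`, landed), which is
  what turns KS's TIME-ZERO Condition G1 over the admissible family into Condition G2 for the SAW
  (KS §4.1.6); it is an input of stub S2's proof, not a hypothesis of the skeleton.

## The cut (three stubs)

* S1 `stub_admissibleG1` — THE OPEN ESTIMATE (XL, research-open): Kemppainen–Smirnov's time-zero
  Condition G1 (`Literature…ConditionG1`, KS eq. (4)) with ONE constant for the ADMISSIBLE family of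
  critical `ℤ²`-SAW laws: simply connected polyomino cell domains `U(S, δ)`, boundary start and
  target. VERBATIM the statement of item stmt-CriticalPhenomena-11346
  (`SAWParafermion.KSAdmissibleG1`, the planner-repaired typing that replaced the polyline-slit
  `KSConditionG2` stmt-0791; a proof of either closes the other by `exact`). No FKG / RSW at `n = 0`;
  only sub-ballisticity (Duminil-Copin–Hammond 2013) is unconditional.
* S2 `stub_ksRegularAlongMesh_of_G1` — THE KS ENGINE FOR THE SAW (XL formalisation of printed
  mathematics): S1 ⇒ for TAME data (eventually: `Ω_δ` is the subgraph of `ℤ²` induced on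
  `meshDomain D δ`, its lattice complement is connected, `a_δ`, `b_δ` are boundary vertices) and
  every chordal `φ`, the SAW laws are `IsKSRegularAlongMesh` — KS Prop. 3.2, Thms. 3.9–3.10, §3.5
  run in KS's LATTICE (cell-domain) convention §4.1.6 (domain Markov ⇒ G2 from G1; the tree's
  continuum-slit `ConditionG2` is FALSE for SAW polylines, twin dead-line note), plus the cell-polygon
  Dobrushin domains of admissible polyominoes with uniformizing maps `φ_δ → φ` ((U1), (U2),
  `b_δ → b`; Carathéodory/Radó).
* S3 `stub_tameReduction` — THE RESIDUE (open; the recorded obstruction of every KS-fed line on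
  SAW subsequential-limit cruxes as typed, `Cruxes/SimpleSubseqLimits/Lines/capacity-clock-no-plateau-dead.md`):
  describability of subsequential limits for all TAME data of all Dobrushin domains ⇒ the same for
  ALL data allowed by `IsEndpointApprox` (interior roots at mesoscopic depth; Jordan domains whose
  mesh graphs lose edges to the closed-segment rule or whose polyomino has lattice holes). For
  interior-rooted data `IsKSRegularAlongMesh` itself is false (no Jordan domain carries, as chordal
  curves from a boundary point, walks that wind around their root), so this reduction cannot be
  bypassed inside KS's framework; the route header's recorded pivot is to restate the crux for
  boundary-attached endpoint approximations (kill criteria of SAWImaginaryGeometry; EndpointRobust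
  stmt-0776).

`SubseqDescribable_of` (kernel-checked, no `sorry` of its own): S3 reduces to tame data; there S2 fed
with S1 gives `IsKSRegularAlongMesh`, and the proved passage gives a.e. describability; conclusion =
the route decl BY NAME.
-/

noncomputable section

open MeasureTheory Filter Topology Set Metric
open Literature.Probability.RandomPlanarGeometry Literature.Probability.LatticeModels
open UpperHalfPlane (upperHalfPlaneSet)
open scoped ENNReal NNReal BoundedContinuousFunction

namespace Summit.CriticalPhenomena.SAWScalingLimit.Cruxes.SubseqDescribable.Birth

/-! ### Vocabulary of the line (for reading; the stubs below inline everything in tree vocabulary) -/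

/-- **KS's admissible family of critical `ℤ²`-SAW laws** (KS 2017 §4.1.3–4.1.6): the pushed-forward
critical SAW laws of the plain square-cell domains `U(S, δ)` of simply connected polyominoes `S`
(connected, connected lattice complement) between BOUNDARY vertices `a, b` — verbatim the inline
family of item stmt-CriticalPhenomena-11346 `SAWParafermion.KSAdmissibleG1`. -/
def admissibleFamily : Set MarkedLaw :=
  {L : MarkedLaw | ∃ (S : Finset (Site 2)) (δ : ℝ) (a b : Site 2),
    let U : Set ℂ := interior (⋃ v ∈ S, {z : ℂ | |z.re - (meshPoint δ v).re| ≤ δ / 2 ∧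
      |z.im - (meshPoint δ v).im| ≤ δ / 2});
    0 < δ ∧ ((zdGraph 2).induce (↑S : Set (Site 2))).Preconnected ∧
      ((zdGraph 2).induce ((↑S : Set (Site 2))ᶜ)).Preconnected ∧ a ∈ S ∧ b ∈ S ∧
      (∃ w ∉ S, (zdGraph 2).Adj a w) ∧ (∃ w ∉ S, (zdGraph 2).Adj b w) ∧
      L = ⟨U, meshPoint δ a, meshPoint δ b, (SAW.law U δ a b).map (fun γ => γ.curve)⟩}

/-- **S1, named.** Time-zero Condition G1 for the admissible family (= `KSAdmissibleG1`). -/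
def AdmissibleG1 : Prop :=
  ConditionG1 admissibleFamily

/-- **Tame data** (verbatim the twin skeleton's `IsTame`, `Cruxes/SimpleSubseqLimits/Lines/
capacity-clock-no-plateau.lean`): eventually along `δ → 0⁺`, (i) `Ω_δ = discreteDomainGraph D δ` is
the subgraph of `ℤ²` INDUCED on `meshDomain D δ`, (ii) the lattice complement of `meshDomain D δ` is
connected, (iii) `a δ`, `b δ` are BOUNDARY vertices — the regime in which the SAW law of `Ω_δ` and
all its conditionals on prefixes are members of `admissibleFamily`. -/
def IsTame (D : DobrushinDomain) (a b : ℝ → Site 2) : Prop :=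
  ∀ᶠ δ in 𝓝[>] (0 : ℝ),
    (∀ x y : Site 2, (discreteDomainGraph D.carrier δ).Adj x y ↔
        ((zdGraph 2).Adj x y ∧ x ∈ meshDomain D.carrier δ ∧ y ∈ meshDomain D.carrier δ)) ∧
    ((zdGraph 2).induce (meshDomain D.carrier δ)ᶜ).Preconnected ∧
    (∃ w ∉ meshDomain D.carrier δ, (zdGraph 2).Adj (a δ) w) ∧
    (∃ w ∉ meshDomain D.carrier δ, (zdGraph 2).Adj (b δ) w)

/-- **KS regularity of the critical SAW of `(D; a_δ, b_δ)` along the mesh, towards `(D, φ)`** — the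
Literature interface `IsKSRegularAlongMesh` instantiated on the SAW polylines under `SAW.law`. -/
def SAWKSRegularAlongMesh (D : DobrushinDomain) (a b : ℝ → Site 2)
    (φ : ConformalEquiv upperHalfPlaneSet D.carrier) : Prop :=
  IsKSRegularAlongMesh D φ (Ωδ := fun δ => SAW.DomainSAW D.carrier δ (a δ) (b δ))
    (fun δ γ => γ.curve) (fun δ => SAW.law D.carrier δ (a δ) (b δ))

/-- **The conclusion of the crux at one `(D; a, b)`** (verbatim the crux's clauses after the endpoint
approximation): every subsequential weak limit is a.e. Loewner-describable through every chordal
uniformizing map. -/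
def DescribableAt (D : DobrushinDomain) (a b : ℝ → Site 2) : Prop :=
  ∀ (s : ℕ → ℝ) (μ : Measure (CurveClass ℂ)), Tendsto s atTop (𝓝[>] (0 : ℝ)) →
    IsProbabilityMeasure μ →
    (∀ f : BoundedContinuousFunction (CurveClass ℂ) ℝ,
      Tendsto (fun n => ∫ γ, f γ.curve ∂(SAW.law D.carrier (s n) (a (s n)) (b (s n)))) atTop
        (𝓝 (∫ x, f x ∂μ))) →
    ∀ φ : ConformalEquiv upperHalfPlaneSet D.carrier, D.IsChordalUniformizing φ →
      ∀ᵐ c ∂μ, IsLoewnerDescribable φ c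

/-- **S2, named.** G1 over the admissible family ⇒ KS regularity along the mesh for tame data. -/
def KSRegularOfG1 : Prop :=
  AdmissibleG1 → ∀ (D : DobrushinDomain) (a b : ℝ → Site 2), SAW.IsEndpointApprox D a b →
    IsTame D a b → ∀ φ : ConformalEquiv upperHalfPlaneSet D.carrier, D.IsChordalUniformizing φ →
      SAWKSRegularAlongMesh D a b φ

/-- **S3, named.** Tame reduction: describability for tame data of all domains ⇒ for all data. -/
def TameReduction : Prop :=
  (∀ (D : DobrushinDomain) (a b : ℝ → Site 2), SAW.IsEndpointApprox D a b → IsTame D a b →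
      DescribableAt D a b) →
    ∀ (D : DobrushinDomain) (a b : ℝ → Site 2), SAW.IsEndpointApprox D a b → DescribableAt D a b

/-! ### The proved passage: KS regularity along the mesh ⇒ describable subsequential limits -/

/-- **Passage (proved).** If the critical SAW laws of `(D; a_δ, b_δ)` are Kemppainen–Smirnov regular
along the mesh towards `(D, φ)` (`IsKSRegularAlongMesh`: approximating Dobrushin domains `D_δ` and
chordal maps `φ_δ → φ` with (U1), (U2), `b_δ → b`, and for every `ε` ONE regularity class of mass
`≥ 1 − ε` for all small `δ`), then every weak limit `ν` (a probability measure) of the laws along any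
`s n → 0⁺` is `ν`-a.e. described by the Loewner evolution through `φ`. Proof: the laws are honest for
`n ≥ N₀` (`Negative.eventually_isProbabilityMeasure_of_weakLimitAlong`); along the honest tail
`n ↦ s (n + N₀) → 0⁺` the mesh-indexed data restrict to sequence-indexed data
(`TendstoUniformlyOn.seq_tendstoUniformlyOn`, `Tendsto.eventually`), and the landed eventual form of
KS Thm. 1.5 (ii) `CapacityClock.Describable.ae_isLoewnerDescribable_of_eventually_regular` concludes.
[cite: KemppainenSmirnov2017, Thm. 1.5, Cor. 1.7, Cor. 1.8] -/
theorem ae_isLoewnerDescribable_of_isKSRegularAlongMesh {D : DobrushinDomain} {a b : ℝ → Site 2}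
    {φ : ConformalEquiv upperHalfPlaneSet D.carrier} (hφ : D.IsChordalUniformizing φ)
    (hKS : SAWKSRegularAlongMesh D a b φ)
    {s : ℕ → ℝ} (hs : Tendsto s atTop (𝓝[>] (0 : ℝ))) {ν : Measure (CurveClass ℂ)}
    [IsProbabilityMeasure ν]
    (hw : ∀ f : CurveClass ℂ →ᵇ ℝ,
      Tendsto (fun n => ∫ γ, f γ.curve ∂(SAW.law D.carrier (s n) (a (s n)) (b (s n)))) atTop
        (𝓝 (∫ x, f x ∂ν))) :
    ∀ᵐ c ∂ν, IsLoewnerDescribable φ c := by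
  obtain ⟨Dd, φd, hφd, hU1, hU2, hb, hreg⟩ := hKS
  -- (1) honesty of the laws along a tail of the sequence
  obtain ⟨N₀, hN₀⟩ := eventually_atTop.1
    (Summit.CriticalPhenomena.SAWScalingLimit.Theorems.SimpleSubseqLimits.Negative.eventually_isProbabilityMeasure_of_weakLimitAlong
      (D := D) (a := a) (b := b) (s := s) (ν := ν) hw)
  have hT := tendsto_add_atTop_nat N₀
  have hs' : Tendsto (fun n ↦ s (n + N₀)) atTop (𝓝[>] (0 : ℝ)) := hs.comp hT
  haveI hP : ∀ n, IsProbabilityMeasure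
      (SAW.law D.carrier (s (n + N₀)) (a (s (n + N₀))) (b (s (n + N₀)))) :=
    fun n ↦ (hN₀ (n + N₀) (Nat.le_add_left N₀ n)).1
  -- (2) the eventual, sequence-indexed form of KS Thm. 1.5 (ii) along the honest tail
  refine Summit.CriticalPhenomena.SAWScalingLimit.Theorems.SimpleSubseqLimits.CapacityClock.Describable.ae_isLoewnerDescribable_of_eventually_regular
    (Ds := fun n ↦ Dd (s (n + N₀))) (φs := fun n ↦ φd (s (n + N₀)))
    (Ω := fun n ↦ SAW.DomainSAW D.carrier (s (n + N₀)) (a (s (n + N₀))) (b (s (n + N₀))))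
    (Y := fun n γ ↦ γ.curve)
    (P := fun n ↦ SAW.law D.carrier (s (n + N₀)) (a (s (n + N₀))) (b (s (n + N₀))))
    hφ (fun n ↦ hφd _) (fun R ↦ (hU1 R).seq_tendstoUniformlyOn (fun n ↦ s (n + N₀)) hs')
    (fun ε hε ↦ ?_) (hb.comp hs') (fun n ↦ SAW.aemeasurable_curve _ _ _ _)
    (fun f ↦ (hw f).comp hT) (fun ε hε ↦ ?_)
  · obtain ⟨r, hr⟩ := hU2 ε hε
    exact ⟨r, hs'.eventually hr⟩
  · obtain ⟨𝔯, h𝔯⟩ := hreg ε hε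
    exact ⟨𝔯, hs'.eventually h𝔯⟩

/-! ### The stubs (the ONLY `sorry`s of this file)

Each stub is stated over TREE VOCABULARY ONLY (the named statements above unfolded by hand), so that it
lands verbatim as a `Theorems/SAWImaginaryGeometrySubseqDescribable<Stub>.lean --supports
stmt-CriticalPhenomena-5943` (imports needed there: `SelfAvoidingWalk`, `CrossingCondition`,
`LatticeFlowLinePassage`); the `*_holds` theorems below certify definitionally (`:= stub_…`) that the
unfolded text IS the named statement. -/

/-- **S1 — Kemppainen–Smirnov's time-zero Condition G1 for the admissible family of critical
`ℤ²`-SAW laws** (VERBATIM item stmt-CriticalPhenomena-11346 `SAWParafermion.KSAdmissibleG1`): there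
is `C > 1` such that for every simply connected polyomino `S` (connected, connected lattice
complement), mesh `δ > 0`, boundary vertices `a, b` of `S` and annulus `A(z₀, r, R)` with `R ≥ C r`,
the critical SAW of the cell domain `U(S, δ)` from `a` to `b` makes a crossing of `A` inside the
avoidable part `A^u` with probability `≤ 1/2` (KS 2017 eq. (3)–(4), §4.1.6: by the exact domain
Markov property this is the substance of Condition G2 for the SAW). Open: no FKG / RSW at `n = 0`
(KS §4 verifies G-conditions for FK, percolation, harmonic explorer, LERW only; UST fails G2, §4.5);
sub-ballisticity (Duminil-Copin–Hammond 2013) is the only unconditional input. -/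
theorem stub_admissibleG1 :
    ConditionG1 {L : MarkedLaw | ∃ (S : Finset (Site 2)) (δ : ℝ) (a b : Site 2),
      let U : Set ℂ := interior (⋃ v ∈ S, {z : ℂ | |z.re - (meshPoint δ v).re| ≤ δ / 2 ∧
        |z.im - (meshPoint δ v).im| ≤ δ / 2});
      0 < δ ∧ ((zdGraph 2).induce (↑S : Set (Site 2))).Preconnected ∧
        ((zdGraph 2).induce ((↑S : Set (Site 2))ᶜ)).Preconnected ∧ a ∈ S ∧ b ∈ S ∧
        (∃ w ∉ S, (zdGraph 2).Adj a w) ∧ (∃ w ∉ S, (zdGraph 2).Adj b w) ∧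
        L = ⟨U, meshPoint δ a, meshPoint δ b, (SAW.law U δ a b).map (fun γ => γ.curve)⟩} := by
  sorry

/-- **S2 — the Kemppainen–Smirnov engine for the SAW: time-zero G1 over the admissible family ⇒ KS
regularity along the mesh for tame data.** Under S1, for every Dobrushin domain, every TAME endpoint
approximation and every chordal uniformizing map `φ`, the critical SAW laws are
`IsKSRegularAlongMesh D φ curve law`: there are Dobrushin domains `D_δ` (the cell polygons of
`meshDomain D δ`, corner wedges at the two roots) with chordal maps `φ_δ → φ` ((U1) on the compacts
of the closed half-plane, (U2) at infinity, `b_δ → b` — kernel convergence of the cell polygons plus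
Radó-type boundary convergence) and, for every `ε`, ONE regularity class `regularCurves (φ_δ) 𝔯`
(transience at `b_δ`, capacity schedule, driving and tip moduli: KS Prop. 3.2, Thms. 3.9–3.10, §3.5)
of mass `≥ 1 − ε` for all small `δ`. Plan: under tameness the SAW law of `Ω_δ` IS the law of the cell
domain `U(meshDomain D δ, δ)` between boundary vertices (`cellGraph_adj_iff`, landed), the exact domain
Markov property (`DomainMarkov.stub_sawDomainMarkov`, landed) makes every conditional law given a
prefix a member of the admissible family, so S1 is Condition G2 in KS's lattice convention §4.1.6,
and KS's probabilistic half is run in that convention (the tree's continuum-slit `ConditionG2` /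
`exists_regularity_of_conditionG2` cannot be fed: lattice-sealed pockets are continuum-unforced). -/
theorem stub_ksRegularAlongMesh_of_G1 :
    ConditionG1 {L : MarkedLaw | ∃ (S : Finset (Site 2)) (δ : ℝ) (a b : Site 2),
      let U : Set ℂ := interior (⋃ v ∈ S, {z : ℂ | |z.re - (meshPoint δ v).re| ≤ δ / 2 ∧
        |z.im - (meshPoint δ v).im| ≤ δ / 2});
      0 < δ ∧ ((zdGraph 2).induce (↑S : Set (Site 2))).Preconnected ∧
        ((zdGraph 2).induce ((↑S : Set (Site 2))ᶜ)).Preconnected ∧ a ∈ S ∧ b ∈ S ∧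
        (∃ w ∉ S, (zdGraph 2).Adj a w) ∧ (∃ w ∉ S, (zdGraph 2).Adj b w) ∧
        L = ⟨U, meshPoint δ a, meshPoint δ b, (SAW.law U δ a b).map (fun γ => γ.curve)⟩} →
    ∀ (D : DobrushinDomain) (a b : ℝ → Site 2), SAW.IsEndpointApprox D a b →
      (∀ᶠ δ in 𝓝[>] (0 : ℝ),
        (∀ x y : Site 2, (discreteDomainGraph D.carrier δ).Adj x y ↔
            ((zdGraph 2).Adj x y ∧ x ∈ meshDomain D.carrier δ ∧ y ∈ meshDomain D.carrier δ)) ∧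
        ((zdGraph 2).induce (meshDomain D.carrier δ)ᶜ).Preconnected ∧
        (∃ w ∉ meshDomain D.carrier δ, (zdGraph 2).Adj (a δ) w) ∧
        (∃ w ∉ meshDomain D.carrier δ, (zdGraph 2).Adj (b δ) w)) →
      ∀ φ : ConformalEquiv upperHalfPlaneSet D.carrier, D.IsChordalUniformizing φ →
        IsKSRegularAlongMesh D φ (Ωδ := fun δ => SAW.DomainSAW D.carrier δ (a δ) (b δ))
          (fun δ γ => γ.curve) (fun δ => SAW.law D.carrier δ (a δ) (b δ)) := by
  sorry

/-- **S3 — tame reduction (the residue).** If for every Dobrushin domain and every TAME endpoint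
approximation all subsequential weak limits of the critical SAW laws are a.e. Loewner-describable
through every chordal uniformizing map, then the same holds for every endpoint approximation allowed
by `SAW.IsEndpointApprox`. Two halves: (domain) Jordan domains whose mesh graphs are not induced or
whose polyomino has lattice holes — comparison with the SAW of tame inner/filled domains needs a
boundary-avoidance / restriction input this route does not file; (root) interior roots `a_δ`, `b_δ`
at depth `≫ δ` — insensitivity of subsequential limits to the microscopic root data (lattice effects
cancel in the normalised law, Kennedy–Lawler arXiv:1109.3091; reversal handles one end), for which
KS's framework is silent (walks wind around an interior root, so no chordal embedding exists). This
is the recorded obstruction of the twin crux's KS-fed line (`capacity-clock-no-plateau-dead.md`); the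
planner-level alternative is the route's own kill-criteria pivot (restate the crux for
boundary-attached, tame approximations; EndpointRobust stmt-0776). -/
theorem stub_tameReduction :
    (∀ (D : DobrushinDomain) (a b : ℝ → Site 2), SAW.IsEndpointApprox D a b →
      (∀ᶠ δ in 𝓝[>] (0 : ℝ),
        (∀ x y : Site 2, (discreteDomainGraph D.carrier δ).Adj x y ↔
            ((zdGraph 2).Adj x y ∧ x ∈ meshDomain D.carrier δ ∧ y ∈ meshDomain D.carrier δ)) ∧
        ((zdGraph 2).induce (meshDomain D.carrier δ)ᶜ).Preconnected ∧
        (∃ w ∉ meshDomain D.carrier δ, (zdGraph 2).Adj (a δ) w) ∧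
        (∃ w ∉ meshDomain D.carrier δ, (zdGraph 2).Adj (b δ) w)) →
      ∀ (s : ℕ → ℝ) (μ : Measure (CurveClass ℂ)), Tendsto s atTop (𝓝[>] (0 : ℝ)) →
        IsProbabilityMeasure μ →
        (∀ f : BoundedContinuousFunction (CurveClass ℂ) ℝ,
          Tendsto (fun n => ∫ γ, f γ.curve ∂(SAW.law D.carrier (s n) (a (s n)) (b (s n)))) atTop
            (𝓝 (∫ x, f x ∂μ))) →
        ∀ φ : ConformalEquiv upperHalfPlaneSet D.carrier, D.IsChordalUniformizing φ →
          ∀ᵐ c ∂μ, IsLoewnerDescribable φ c) →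
    ∀ (D : DobrushinDomain) (a b : ℝ → Site 2), SAW.IsEndpointApprox D a b →
      ∀ (s : ℕ → ℝ) (μ : Measure (CurveClass ℂ)), Tendsto s atTop (𝓝[>] (0 : ℝ)) →
        IsProbabilityMeasure μ →
        (∀ f : BoundedContinuousFunction (CurveClass ℂ) ℝ,
          Tendsto (fun n => ∫ γ, f γ.curve ∂(SAW.law D.carrier (s n) (a (s n)) (b (s n)))) atTop
            (𝓝 (∫ x, f x ∂μ))) →
        ∀ φ : ConformalEquiv upperHalfPlaneSet D.carrier, D.IsChordalUniformizing φ →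
          ∀ᵐ c ∂μ, IsLoewnerDescribable φ c := by
  sorry

/-! ### Consistency: each named statement IS its registered stub (definitionally) -/

theorem admissibleG1_holds : AdmissibleG1 := stub_admissibleG1
theorem ksRegularOfG1_holds : KSRegularOfG1 := stub_ksRegularAlongMesh_of_G1
theorem tameReduction_holds : TameReduction := stub_tameReduction

/-! ### Name-keyed aliases of the three statements — the hypotheses of `SubseqDescribable_of`

The native skeleton audit (`#h21_check_skeleton`) admits a hypothesis of the skeleton theorem only if its
head constant is a registered obligation or is NAMED like a declared stub; `__Registered.stub_X` is the
statement of `stub_X` under that name (device of `Cruxes/AxiomsOfLimit/Lines/birth.lean` and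
`Cruxes/SubseqSimple/Lines/birth.lean`; the `__` namespace is an implementation detail, so the audit's
stub report resolves each `stub_…` to the sorried theorem, not to the alias). -/
namespace __Registered

/-- Alias of `AdmissibleG1` keyed by the registered stub name. -/
abbrev stub_admissibleG1 : Prop := AdmissibleG1
/-- Alias of `KSRegularOfG1` keyed by the registered stub name. -/
abbrev stub_ksRegularAlongMesh_of_G1 : Prop := KSRegularOfG1
/-- Alias of `TameReduction` keyed by the registered stub name. -/
abbrev stub_tameReduction : Prop := TameReduction

end __Registered

/-! ### The skeleton theorem: the three stubs imply the crux, BY NAME -/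

/-- **`SubseqDescribable` from the line `birth`** (kernel-checked, no `sorry` of its own). By S3 it
suffices to treat TAME data; there S2 fed with S1 gives KS regularity of the SAW laws along the mesh
towards `(D, φ)`, and the proved passage `ae_isLoewnerDescribable_of_isKSRegularAlongMesh` (honest
tail + the landed eventual form of KS Thm. 1.5 (ii)) gives `μ`-a.e. describability through `φ` of
every subsequential weak limit. Hypotheses = the three stubs under their registered names;
conclusion = the route decl by name. -/
theorem SubseqDescribable_of (h₁ : __Registered.stub_admissibleG1)
    (h₂ : __Registered.stub_ksRegularAlongMesh_of_G1) (h₃ : __Registered.stub_tameReduction) :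
    Summit.CriticalPhenomena.SAWScalingLimit.Theses.SAWImaginaryGeometry.SubseqDescribable := by
  intro D a b hab s μ hs hμ hlim φ hφ
  refine h₃ (fun D' a' b' hab' hT' s' μ' hs' hμ' hlim' φ' hφ' => ?_) D a b hab s μ hs hμ hlim φ hφ
  haveI := hμ'
  exact ae_isLoewnerDescribable_of_isKSRegularAlongMesh hφ' (h₂ h₁ D' a' b' hab' hT' φ' hφ') hs' hlim'

/-- Wiring check (an `example`, so that `SubseqDescribable_of` stays the only theorem concluding the
crux): the registered stubs, with their tree-vocabulary types, feed the skeleton theorem as stated —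
this term becomes the crux proof when the three `sorry`s above are discharged. -/
example : Summit.CriticalPhenomena.SAWScalingLimit.Theses.SAWImaginaryGeometry.SubseqDescribable :=
  SubseqDescribable_of stub_admissibleG1 stub_ksRegularAlongMesh_of_G1 stub_tameReduction

end Summit.CriticalPhenomena.SAWScalingLimit.Cruxes.SubseqDescribable.Birth

end
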